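import Mathlib
import Summits.Ventures.PercRepro2.Defs
import Summits.Ventures.PercRepro2.Independence
import Summits.Ventures.PercRepro2.Harris
import Summits.Ventures.PercRepro2.Graph
import Summits.Ventures.PercRepro2.Events
import Summits.Ventures.PercRepro2.BHKEvents
import Summits.Ventures.PercRepro2.BHKAvoid
import Summits.Ventures.PercRepro2.SameClusterAvoid

/-!
# The same-cluster / cross-cluster BHK pair (blind cell PercRepro2, p2 g27)

Conditionally on the avoidance `s ↮ t` (or `s ↮ X` with `t ∈ X`), for up-sets `𝓤, 𝓥` of
vertex sets read on the cluster of `s` and an up-set `𝓦` read on the cluster of `t`, the two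
halves of van den Berg–Häggström–Kahn (2006, doi:10.1002/rsa.20102) multiply to a single
three-event inequality, stated division-free:

  `P(C_s ∈ 𝓤, s↮t) · P(C_s ∈ 𝓥, C_t ∈ 𝓦, s↮t) ≤ P(C_t ∈ 𝓦, s↮t) · P(C_s ∈ 𝓤, C_s ∈ 𝓥, s↮t)`

(`bhk_same_cross_pair`; with a set `X ∋ t` avoided, `bhk_same_cross_pair_avoid`).  In conditional
form: `P(𝓤 | s↮t) · P(𝓥 ∩ 𝓦 | s↮t) ≤ P(𝓦 | s↮t) · P(𝓤 ∩ 𝓥 | s↮t)` — replacing, in a product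
with the `C_s`-event `𝓥`, the `C_t`-event `𝓦` by the `C_s`-event `𝓤` can only lower the
left-hand product relative to the right: the same-cluster factor (BHK Thm 1.3, positive
association of `C_s` given `s ↮ t`) beats the cross-cluster factor (BHK Thm 1.4, negative
correlation of `C_s` and `C_t` given `s ↮ t`).  Proof: multiply Thm 1.3 for `(𝓤, 𝓥)` by
`P(𝓦, s↮t)` and Thm 1.4 for `(𝓥, 𝓦)` by `P(𝓤, s↮t)`, chain, and cancel `P(s↮t)` (every term
vanishes when it is `0`).  The instance `s := y`, `t := u`, `𝓤 = {s ∈ ·}`, `𝓥 = {o ∈ ·}`,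
`𝓦 = {s ∈ ·}` is the theorem (C-yu) of XWEdgeYUNonneg.lean.  Own work; standard axioms.
-/

namespace Summit.Ventures.PercRepro2

namespace BHKSameCrossPair

variable {V : Type*} {E : Type*} [Fintype E] [DecidableEq E] [Fintype V] [DecidableEq V]
  {R : Type*} [CommRing R] [LinearOrder R] [IsStrictOrderedRing R]

/-- The cancellation step shared by both versions: from `a1 : A * Bv ≤ C * d`,
`b1 : Y * d ≤ Bv * W` with `A, W ≤ d`, deduce `A * Y ≤ W * C`. -/
lemma cancel_aux {A Bv C d Y W : R} (hA : 0 ≤ A) (hW : 0 ≤ W) (hd : 0 ≤ d) (hAd : A ≤ d)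
    (hWd : W ≤ d) (a1 : A * Bv ≤ C * d) (b1 : Y * d ≤ Bv * W) : A * Y ≤ W * C := by
  have e1 := mul_le_mul_of_nonneg_left a1 hW
  have e2 := mul_le_mul_of_nonneg_left b1 hA
  have key : A * Y * d ≤ W * C * d := by nlinarith
  rcases hd.lt_or_eq with hd0 | hd0
  · exact le_of_mul_le_mul_right key hd0
  · have hA0 : A = 0 := le_antisymm (hd0 ▸ hAd) hA
    have hW0 : W = 0 := le_antisymm (hd0 ▸ hWd) hW
    rw [hA0, hW0, zero_mul, zero_mul]

/-- **The BHK pair, one avoided vertex**: for up-sets `𝓤, 𝓥` (read on `C_s`) and `𝓦` (read on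
`C_t`), `P(C_s ∈ 𝓤, s↮t) · P(C_s ∈ 𝓥, C_t ∈ 𝓦, s↮t) ≤ P(C_t ∈ 𝓦, s↮t) · P(C_s ∈ 𝓤, C_s ∈ 𝓥, s↮t)`. -/
theorem bhk_same_cross_pair (p : E → R) (hp : IsProbVec p) (ends : E → Sym2 V) (s t : V)
    {𝓤 𝓥 𝓦 : Set (Set V)} (h𝓤 : IsUpperSet 𝓤) (h𝓥 : IsUpperSet 𝓥) (h𝓦 : IsUpperSet 𝓦) :
    prob p (clusterInEvent ends s 𝓤 ∩ (connEvent ends s t)ᶜ) *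
        prob p (clusterInEvent ends s 𝓥 ∩ clusterInEvent ends t 𝓦 ∩ (connEvent ends s t)ᶜ) ≤
      prob p (clusterInEvent ends t 𝓦 ∩ (connEvent ends s t)ᶜ) *
        prob p (clusterInEvent ends s 𝓤 ∩ clusterInEvent ends s 𝓥 ∩ (connEvent ends s t)ᶜ) := by
  have a1 := bhk_same_cluster_events p hp ends s t h𝓤 h𝓥
  have b1 := bhk_cross_cluster p hp ends s t h𝓥 h𝓦
  exact cancel_aux (prob_nonneg hp _) (prob_nonneg hp _) (prob_nonneg hp _)
    (prob_mono hp Set.inter_subset_right) (prob_mono hp Set.inter_subset_right) a1 b1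

/-- **The BHK pair, a set `X ∋ t` avoided by `s`**:
`P(C_s ∈ 𝓤, s↮X) · P(C_s ∈ 𝓥, C_t ∈ 𝓦, s↮X) ≤ P(C_t ∈ 𝓦, s↮X) · P(C_s ∈ 𝓤 ∩ 𝓥, s↮X)`. -/
theorem bhk_same_cross_pair_avoid (p : E → R) (hp : IsProbVec p) (ends : E → Sym2 V) (s t : V)
    {X : Finset V} (ht : t ∈ X) {𝓤 𝓥 𝓦 : Set (Set V)} (h𝓤 : IsUpperSet 𝓤) (h𝓥 : IsUpperSet 𝓥)
    (h𝓦 : IsUpperSet 𝓦) :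
    prob p (clusterInEvent ends s 𝓤 ∩ avoidAll ends s X) *
        prob p (clusterInEvent ends s 𝓥 ∩ clusterInEvent ends t 𝓦 ∩ avoidAll ends s X) ≤
      prob p (clusterInEvent ends t 𝓦 ∩ avoidAll ends s X) *
        prob p (clusterInEvent ends s (𝓤 ∩ 𝓥) ∩ avoidAll ends s X) := by
  have a1 := bhk_same_cluster_events_avoid p hp ends s X h𝓤 h𝓥
  have b1 := bhk_cross_cluster_avoid p hp ends s t ht h𝓥 h𝓦
  exact cancel_aux (prob_nonneg hp _) (prob_nonneg hp _) (prob_nonneg hp _)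
    (prob_mono hp Set.inter_subset_right) (prob_mono hp Set.inter_subset_right) a1 b1

/-- **Connection-event reading of the pair** (vertices `a, b` on the side of `s`, `c` on the side
of `t`): `P(s↔a, s↮t) · P(s↔b, t↔c, s↮t) ≤ P(t↔c, s↮t) · P(s↔a, s↔b, s↮t)`. -/
theorem conn_same_cross_pair (p : E → R) (hp : IsProbVec p) (ends : E → Sym2 V) (s t a b c : V) :
    prob p (connEvent ends s a ∩ (connEvent ends s t)ᶜ) *
        prob p (connEvent ends s b ∩ connEvent ends t c ∩ (connEvent ends s t)ᶜ) ≤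
      prob p (connEvent ends t c ∩ (connEvent ends s t)ᶜ) *
        prob p (connEvent ends s a ∩ connEvent ends s b ∩ (connEvent ends s t)ᶜ) := by
  have h := bhk_same_cross_pair p hp ends s t (𝓤 := {W | a ∈ W}) (𝓥 := {W | b ∈ W})
    (𝓦 := {W | c ∈ W}) (fun _ _ h ha => h ha) (fun _ _ h hb => h hb) (fun _ _ h hc => h hc)
  have e : ∀ (x v : V), clusterInEvent ends x {W | v ∈ W} = connEvent ends x v := by
    intro x v
    ext ω
    simp only [mem_clusterInEvent, Set.mem_setOf_eq, mem_cluster, mem_connEvent]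
  simp only [e] at h
  exact h

end BHKSameCrossPair

end Summit.Ventures.PercRepro2
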